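import Summits.AtomisticToContinuum.Crystallization.Theorems.OverbindingBudgetAffineFarCoreCertificate
import Summits.AtomisticToContinuum.Crystallization.Theorems.OverbindingBudgetAffineTwoShellWindow
import Literature.MathematicalPhysics.StatisticalMechanics.BarlowStackingEnergy

/-!
(SPLIT FOR THE 400-LINE CAP by the landing lane, hand-2 g30: this file = part 1 of 4; sequels `…OverbindingBudgetAffineFarCoreWindowsB`, `…OverbindingBudgetAffineFarCoreWindowsC`, `…OverbindingBudgetAffineFarCoreWindows` import it in a chain; same namespace, all FQNs unchanged.)
# OverbindingBudget — Z2-S WINDOW REDUCTION: the registry-free window sums `T₃↑(w, B)`, `T₆↓(w, B)` (layer decomposition of the shape sums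
# over a Barlow stacking, exact layers `|k| ≤ 3`, coset max / min beyond), the row kernels (N♯)/(X4)/(SC)/Gram, and the pattern-map leaf
# (decomp-a2c lens-4, generation 65; critic row 1082 (c); memo `g65/memo/NODE-g65-WindowTable.md` has the per-window numbers)

Imports ONLY the g64 certificate interface `…Theorems.OverbindingBudgetAffineFarCoreCertificate` (`shapeSix`, `shapeTwelve`, `CoreFarShapeBound`,
`coreFarShapeBound_of_windows`, `not_farShape_of_near`) and the Literature layer geometry `Literature.MathematicalPhysics.StatisticalMechanics.layerVec`
(`BarlowStackingEnergy.lean`, the SOURCE of the layer-vector object: `layerVec` below is an `abbrev` of it at `a = 1`, `h = √(2/3)`, and the coordinate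
simp lemmas are its `layerVec_apply_*`, primed here); restates nothing else.  PROVED, 0 sorry:
* §1 LAYER COORDINATES.  `layerVec i j o k = i u + j v + o w + k √(2/3) e₃` (`abbrev` of the Literature `layerVec 1 √(2/3) o k i j`; the Literature's
  `barlowPos 1 √(2/3) s k i j` is DEFINITIONALLY `layerVec i j (haggLabel s k) k`); its coordinates (primed simp lemmas), `3‖layerVec‖² = 3(i²+ij+j²) + 3o(i+j) + o² + 2k²`, the coset shift `o ↦ o + 3q` = the in-layer
  translation `(i, j) ↦ (i+q, j+q)`, the point reflection, the coordinate comparison `(i²+j²+k²)/8 ≤ ‖·‖²` for `|o| ≤ |k|` and `1 ≤ ‖·‖` for `|k| ≥ 2`.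
* §2 LAYER SUMS.  `layerTerm B n k o (i,j) = ‖B(layerVec i j o k)‖⁻ⁿ`, `layerSum B n k o = Σ'_{(i,j) ∈ ℤ²} layerTerm …` — a function of the linear part
  `B`, the layer index `k` and the lateral label `o` ONLY (registry-free); `layerSum_add_three_mul` / `layerSum_emod_three` (depends on `o mod 3`),
  `layerSum_le_max₃` / `min₃_le_layerSum` (the COSET MAX / MIN bounds), `layerSum_neg_neg` (point-reflection symmetry `(k,o) ↦ (−k,−o)`), and the far-layer
  majorant `layerTerm_far_le` / `summable_layerTerm_far` / `layerSum_far_le` (`|k| ≥ 2`, `o ∈ {0,1,2}`-type labels `|o| ≤ |k|`, `B` within `m ≤ 1/6` of an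
  isometry: domination by the fibre of the g64 majorant `summable_geomMajorant`).
* §3 FUBINI.  ★ `shapeSix_eq_tsum_layerSum` / `shapeTwelve_eq_tsum_layerSum`: for an admissible chart, `shapeSix c = Σ'_k layerSum c.B 6 k (haggLabel c.s k)`
  (and `12`), with the summability of the layer family (`summable_layerSum_chart`).
* §4 WINDOWS.  `windowOf s : Fin 6 → ℤ` (the signs `s(−3) … s(2)`), `windowLabel w k` (the labels of layers `|k| ≤ 3` a window determines;
  `haggLabel_eq_windowLabel`), the WINDOW SUMS `layerUp` / `layerLo` (exact layer sum for `|k| ≤ 3`, coset max resp. min for `|k| > 3`),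
  `windowSixUp w B = Σ'_k layerUp w B 6 k`, `windowTwelveLo w B = Σ'_k layerLo w B 12 k`, their summability, and ★ `shapeSix_le_windowSixUp`,
  ★ `windowTwelveLo_le_shapeTwelve` — the monotone comparison `coreFarShapeBound_of_windows` demands.
* §5 ASSEMBLY.  `WindowGood θ θ₀ τ w B` (some `θ`-admissible, `(θ₀,τ)`-pattern-far chart has window `w` and linear part `B`; `windowGood_isHagg`,
  `windowGood_near` extract what the table uses); ★ `coreFarShapeBound_of_windowSums` — Z2-S from per-window certificates
  `windowSixUp w B ² ≤ 24 Φ windowTwelveLo w B` on `WindowGood`; record corollary ★ `farCoreExcess_record_of_windowSums`.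
* §6 ROW (N♯) — the sharpened non-far ball for windows whose crude row (N) fails (the four c-aligned windows, memo §0): `norm_sub_smul_le_of_near_sharp`
  (pointwise: reference direction `v`, `μ − ⟪v, X s⟫ ≤ (γ + r)²`), kernel `nSharpCheck` over ℚ and ★ `nSharpCheck_sound`, `norm_sum_smul_le` (the cell
  bound for the growth term `‖E w − ⟪v, E s⟫ w‖` from a parametrisation `E = Σ tₐ Eₐ`; it loses `√d` against `σ_max`, see §6d).
* §6b ROW (X4) — the quartic annulus: `X4Row`, `x4Lower`/`x4Chain`/`x4Check` (monotone cells between increasing breakpoints) and ★ `x4Check_sound`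
  (from the window's quartic-model FACT `f(E) ≥ e₀ − g‖E‖ + λ/2‖E‖² − c₃‖E‖³ − c₄‖E‖⁴ − c₅‖E‖⁵` on `‖E‖ ≤ r₁` to `f ≥ φ` on `r₀ ≤ ‖E‖ ≤ r₁`); demo row.
* §6c ROW (SC) — one scale-bad cell: `scCellCheck` and ★ `scCellCheck_sound` (coefficient enclosures + branch point ⇒ `0 ≤ A x² − B x − C` on the branch,
  via the g64 `quad_nonneg_of_le/ge`); demo row with the hcp numbers.
* §6d GRAM CERTIFICATE — the `σ_max` form of the (N♯) growth term: `norm_sq_sum_smul` (`‖Σ tₐ mₐ‖² = Σ tₐ t_b ⟪mₐ, m_b⟫`), `GramCert`/`gramCheck`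
  (rational Gram approximation `Gt ± ε`, diagonal target `L² gₐ`, exact `L D Lᵀ` identity for `diag(L²g − dε) − Gt`) and ★ `gramCheck_sound`
  (perturbation by Cauchy–Schwarz, then sum of squares), ★ `norm_sub_smul_le_of_gram` (`‖E w − ⟪v, E s⟫ w‖ ≤ L r` on the weighted ball `Σ gₐ tₐ² ≤ r²`).
* §8 THE PATTERN-MAP LEAF (task (3)): `FarShape θ' s X μ`, `IsNearest`, the finite rigidity leaf ★ `PatternRigid m τ₀` [ATTACKABLE·M: pattern maps close to
  linear frames are restrictions of isometries], `chart_isNearest` (`nn/a₀ ∈ [5/6, 7/6]` is the nearest distance of `B`), `chart_normalised_near`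
  (`(a₀/nn)•B` within `2/5` of an isometry), ★ `farShape_of_patternFar` (PROVED: `PatternRigid (2/5) τ →` admissible `→ PatternFar θ₀ τ → FarShape (θ₀ − τ)`),
  the zone-I-free table region `FarWindowGood`, ★ `coreFarShapeBound_of_farWindows` and the record ★ `farCoreExcess_record_of_farWindows`
  (`HcpEnergyUpper u ∧ PatternRigid (2/5) τ ∧` per-far-window certificates `⇒ FarCoreExcess (1/25) (1/2000) (1/(2·10⁷))`).
* §9 (with `…TwoShellWindow`: the two shells / the first shell of a chart are the 18 / 12 index triples `twoShellIdx` / `firstShellIdx (w 3) (−w 2)` of its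
  WINDOW) — `wPos w t`, ★ `farShape_iff_finite`, ★ `isNearest_iff_finite`, `FarWindowData` (the finite data a table row receives), ★ `farWindowData_of_good`,
  ★ `coreFarShapeBound_of_farWindowData`, ★ `farCoreExcess_record_of_farWindowData` (the record from a table over finite far-window data).
NOT here: the numerical evaluation of `layerSum` to `10⁻⁹` (truncation + Euler–Maclaurin/coset-tail enclosures) and the proof of `PatternRigid` (finite
enumeration over `ℤ[√2, √3]`, next generation).
-/

namespace Summit.AtomisticToContinuum.Crystallization.Theorems.OverbindingBudgetAffineFarSmoothSplit

open scoped BigOperators Classical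
open Literature.MathematicalPhysics.StatisticalMechanics
open Literature.Geometry.DiscreteGeometry (fccTwoShellPattern hcpTwoShellPattern)

local notation "E3" => EuclideanSpace ℝ (Fin 3)

/-! ## §1 Layer coordinates -/

/-- The point `(i, j)` of the triangular layer at height `k √(2/3)` carrying the lateral label `o` (offset `o · w`): `i u + j v + o w + k √(2/3) e₃`.
This is NOT a new object: it is the Literature layer vector `Literature.MathematicalPhysics.StatisticalMechanics.layerVec a h δ k i j`
(`Literature/MathematicalPhysics/StatisticalMechanics/BarlowStackingEnergy.lean`) at the record letter `a = 1`, layer height `h = √(2/3)`, in the argument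
order `(i, j, o, k)` used throughout this node — an `abbrev`, definitionally `Literature.MathematicalPhysics.StatisticalMechanics.layerVec 1 (Real.sqrt (2/3)) o k i j`
(review of p850035). -/
noncomputable abbrev layerVec (i j o k : ℤ) : E3 :=
  Literature.MathematicalPhysics.StatisticalMechanics.layerVec 1 (Real.sqrt (2 / 3)) o k i j

/-- The Literature structure point is a layer point with label `haggLabel s k` (definitional). [this file] -/
theorem barlowPos_eq_layerVec (s : ℤ → ℤ) (k i j : ℤ) :
    barlowPos 1 (Real.sqrt (2 / 3)) s k i j = layerVec i j (haggLabel s k) k := rfl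

/-- `barlowTriple s (k, i, j) = layerVec i j (haggLabel s k) k`. [this file] -/
theorem barlowTriple_eq_layerVec (s : ℤ → ℤ) (t : ℤ × ℤ × ℤ) :
    barlowTriple s t = layerVec t.2.1 t.2.2 (haggLabel s t.1) t.1 := rfl

/-- Coordinate `0` of `layerVec` — the Literature simp lemma `Literature.MathematicalPhysics.StatisticalMechanics.layerVec_apply_zero` at `a = 1` (primed name: the unprimed one is the
Literature's, in the namespace this file opens). [formal bookkeeping] -/
@[simp] theorem layerVec_apply_zero' (i j o k : ℤ) : layerVec i j o k 0 = i + j / 2 + o / 2 := by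
  rw [layerVec, Literature.MathematicalPhysics.StatisticalMechanics.layerVec_apply_zero, one_mul]

/-- Coordinate `1` of `layerVec` — the Literature simp lemma `Literature.MathematicalPhysics.StatisticalMechanics.layerVec_apply_one` at `a = 1`. [formal bookkeeping] -/
@[simp] theorem layerVec_apply_one' (i j o k : ℤ) : layerVec i j o k 1 = Real.sqrt 3 / 2 * (j + o / 3) := by
  rw [layerVec, Literature.MathematicalPhysics.StatisticalMechanics.layerVec_apply_one, one_mul]

/-- Coordinate `2` of `layerVec` — the Literature simp lemma `Literature.MathematicalPhysics.StatisticalMechanics.layerVec_apply_two` at `h = √(2/3)`. [formal bookkeeping] -/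
@[simp] theorem layerVec_apply_two' (i j o k : ℤ) : layerVec i j o k 2 = k * Real.sqrt (2 / 3) := by
  rw [layerVec, Literature.MathematicalPhysics.StatisticalMechanics.layerVec_apply_two]

/-- `3‖layerVec i j o k‖² = 3(i² + ij + j²) + 3o(i + j) + o² + 2k²`. [this file] -/
theorem three_mul_norm_sq_layerVec (i j o k : ℤ) :
    3 * ‖layerVec i j o k‖ ^ 2 = 3 * ((i : ℝ) * i + i * j + j * j) + 3 * o * (i + j) + o * o + 2 * k * k := by
  have h3 : Real.sqrt 3 ^ 2 = 3 := Real.sq_sqrt (by norm_num)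
  have h23 : Real.sqrt (2 / 3) ^ 2 = 2 / 3 := Real.sq_sqrt (by norm_num)
  rw [EuclideanSpace.norm_eq, Real.sq_sqrt (Finset.sum_nonneg fun i _ => by positivity), Fin.sum_univ_three]
  rw [layerVec_apply_zero', layerVec_apply_one', layerVec_apply_two']
  simp only [Real.norm_eq_abs, sq_abs]
  linear_combination (3 / 4 * ((j : ℝ) + (o : ℝ) / 3) ^ 2) * h3 + (3 * (k : ℝ) ^ 2) * h23

/-- **Coset shift**: raising the label by `3q` is the in-layer translation by `q(u + v)` (`3w = u + v`) — the VECTOR-level sharpening of the Literature's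
norm-level `Literature.MathematicalPhysics.StatisticalMechanics.norm_layerVec_add_three_mul`. [this file] -/
theorem layerVec_add_three_mul (i j o k q : ℤ) : layerVec i j (o + 3 * q) k = layerVec (i + q) (j + q) o k := by
  ext l
  fin_cases l
  · show layerVec i j (o + 3 * q) k 0 = layerVec (i + q) (j + q) o k 0
    simp only [layerVec_apply_zero']; push_cast; ring
  · show layerVec i j (o + 3 * q) k 1 = layerVec (i + q) (j + q) o k 1
    simp only [layerVec_apply_one']; push_cast; ring
  · show layerVec i j (o + 3 * q) k 2 = layerVec (i + q) (j + q) o k 2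
    simp only [layerVec_apply_two']

/-- **Point reflection**: `layerVec (−i) (−j) (−o) (−k) = −layerVec i j o k` — the VECTOR-level sharpening of the Literature's norm-level
`Literature.MathematicalPhysics.StatisticalMechanics.norm_layerVec_neg`. [this file] -/
theorem layerVec_neg (i j o k : ℤ) : layerVec (-i) (-j) (-o) (-k) = -layerVec i j o k := by
  ext l
  fin_cases l
  · show layerVec (-i) (-j) (-o) (-k) 0 = (-layerVec i j o k) 0
    rw [PiLp.neg_apply, layerVec_apply_zero', layerVec_apply_zero']; push_cast; ring
  · show layerVec (-i) (-j) (-o) (-k) 1 = (-layerVec i j o k) 1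
    rw [PiLp.neg_apply, layerVec_apply_one', layerVec_apply_one']; push_cast; ring
  · show layerVec (-i) (-j) (-o) (-k) 2 = (-layerVec i j o k) 2
    rw [PiLp.neg_apply, layerVec_apply_two', layerVec_apply_two']; push_cast; ring

/-- Coordinate comparison `(i² + j² + k²)/8 ≤ ‖layerVec i j o k‖²` whenever `|o| ≤ |k|` (the tree's `sq_coord_le_norm_sq_barlowPos`, label made free). [this file] -/
theorem sq_coord_le_norm_sq_layerVec {o k : ℤ} (ho : |o| ≤ |k|) (i j : ℤ) :
    ((i : ℝ) ^ 2 + (j : ℝ) ^ 2 + (k : ℝ) ^ 2) / 8 ≤ ‖layerVec i j o k‖ ^ 2 := by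
  have hsq := three_mul_norm_sq_layerVec i j o k
  have hℓ : (o : ℝ) ^ 2 ≤ (k : ℝ) ^ 2 := by
    have h' : ((|o| : ℤ) : ℝ) ≤ ((|k| : ℤ) : ℝ) := by exact_mod_cast ho
    push_cast at h'
    nlinarith [abs_nonneg (o : ℝ), sq_abs (o : ℝ), sq_abs (k : ℝ)]
  nlinarith [sq_nonneg ((i : ℝ) + j + o), sq_nonneg (i : ℝ), sq_nonneg (j : ℝ), sq_nonneg (o : ℝ)]

/-- Layers `|k| ≥ 2` are outside the unit ball: `1 ≤ ‖layerVec i j o k‖` (any label). [this file] -/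
theorem one_le_norm_layerVec {k : ℤ} (hk : 2 ≤ |k|) (i j o : ℤ) : 1 ≤ ‖layerVec i j o k‖ := by
  have hsq := three_mul_norm_sq_layerVec i j o k
  have hX : (0 : ℝ) ≤ 3 * ((i : ℝ) * i + i * j + j * j) + 3 * o * (i + j) + o * o := by
    nlinarith [sq_nonneg (2 * (i : ℝ) + j + o), sq_nonneg (3 * (j : ℝ) + o)]
  have hk2 : (4 : ℝ) ≤ (k : ℝ) * k := by
    have h4 : (4 : ℤ) ≤ k * k := by
      rcases abs_cases k with ⟨h, _⟩ | ⟨h, _⟩ <;> nlinarith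
    exact_mod_cast h4
  have hn := norm_nonneg (layerVec i j o k)
  nlinarith

/-- `x⁻⁶ ≤ 272³ (1+k²)⁻¹ (1+i²)⁻¹ (1+j²)⁻¹` for `x ≥ 1` with `(i² + j² + k²)/8 ≤ x²` (the tree's `inv_norm_pow_six_le`, made abstract). [this file] -/
theorem inv_pow_six_le_geom {x : ℝ} {i j k : ℤ} (hx1 : 1 ≤ x) (hS : ((i : ℝ) ^ 2 + (j : ℝ) ^ 2 + (k : ℝ) ^ 2) / 8 ≤ x ^ 2) :
    x⁻¹ ^ 6 ≤ 272 ^ 3 * ((1 + (k : ℝ) ^ 2)⁻¹ * ((1 + (i : ℝ) ^ 2)⁻¹ * (1 + (j : ℝ) ^ 2)⁻¹)) := by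
  obtain ⟨S, hSdef⟩ : ∃ S : ℝ, (i : ℝ) ^ 2 + (j : ℝ) ^ 2 + (k : ℝ) ^ 2 = S := ⟨_, rfl⟩
  obtain ⟨P, hPdef⟩ : ∃ P : ℝ, (1 + (k : ℝ) ^ 2) * ((1 + (i : ℝ) ^ 2) * (1 + (j : ℝ) ^ 2)) = P := ⟨_, rfl⟩
  have hi2 : (0:ℝ) ≤ (i : ℝ) ^ 2 := sq_nonneg _
  have hj2 : (0:ℝ) ≤ (j : ℝ) ^ 2 := sq_nonneg _
  have hk2 : (0:ℝ) ≤ (k : ℝ) ^ 2 := sq_nonneg _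
  have hS0 : 0 ≤ S := by rw [← hSdef]; positivity
  have hP0 : 0 < P := by rw [← hPdef]; positivity
  have hS' : S / 8 ≤ x ^ 2 := by rw [← hSdef]; exact hS
  have hx2 : (1 + S) / 272 ≤ x ^ 2 := by nlinarith
  have hP : P ≤ (1 + S) ^ 3 := by
    rw [← hPdef, ← hSdef]
    have e1 : 1 + (k : ℝ) ^ 2 ≤ 1 + ((i : ℝ) ^ 2 + (j : ℝ) ^ 2 + (k : ℝ) ^ 2) := by linarith
    have e2 : 1 + (i : ℝ) ^ 2 ≤ 1 + ((i : ℝ) ^ 2 + (j : ℝ) ^ 2 + (k : ℝ) ^ 2) := by linarith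
    have e3 : 1 + (j : ℝ) ^ 2 ≤ 1 + ((i : ℝ) ^ 2 + (j : ℝ) ^ 2 + (k : ℝ) ^ 2) := by linarith
    calc (1 + (k : ℝ) ^ 2) * ((1 + (i : ℝ) ^ 2) * (1 + (j : ℝ) ^ 2))
        ≤ (1 + ((i : ℝ) ^ 2 + (j : ℝ) ^ 2 + (k : ℝ) ^ 2)) * ((1 + ((i : ℝ) ^ 2 + (j : ℝ) ^ 2 + (k : ℝ) ^ 2))
            * (1 + ((i : ℝ) ^ 2 + (j : ℝ) ^ 2 + (k : ℝ) ^ 2))) :=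
          mul_le_mul e1 (mul_le_mul e2 e3 (by positivity) (by positivity)) (by positivity) (by positivity)
      _ = _ := by ring
  have hx6 : P / 272 ^ 3 ≤ x ^ 6 := by
    have h3 : ((1 + S) / 272) ^ 3 ≤ (x ^ 2) ^ 3 := pow_le_pow_left₀ (by positivity) hx2 3
    have h4 : P / 272 ^ 3 ≤ ((1 + S) / 272) ^ 3 := by
      rw [div_pow]; exact div_le_div_of_nonneg_right hP (by positivity)
    calc P / 272 ^ 3 ≤ ((1 + S) / 272) ^ 3 := h4
      _ ≤ (x ^ 2) ^ 3 := h3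
      _ = x ^ 6 := by ring
  have hPi : 0 < P / 272 ^ 3 := by positivity
  calc x⁻¹ ^ 6 = (x ^ 6)⁻¹ := by rw [inv_pow]
    _ ≤ (P / 272 ^ 3)⁻¹ := inv_anti₀ hPi hx6
    _ = 272 ^ 3 * P⁻¹ := by rw [inv_div, div_eq_mul_inv]
    _ = _ := by rw [← hPdef, mul_inv, mul_inv]

/-- **Near-isometry transfer**: `‖p‖ ≥ 1`, `‖p‖⁻⁶ ≤ P`, `B` within `m ≤ 1/6` of a linear isometry ⇒ `‖B p‖⁻⁶ ≤ (1−m)⁻⁶ P` and `‖B p‖⁻¹² ≤ (1−m)⁻¹² P`. [this file] -/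
theorem inv_pow_norm_le_of_near {B : E3 →ₗ[ℝ] E3} {m : ℝ} (hm : m ≤ 1 / 6) (hB : ∃ Q : E3 →ₗᵢ[ℝ] E3, ∀ v, ‖B v - Q v‖ ≤ m * ‖v‖)
    {p : E3} (hp1 : 1 ≤ ‖p‖) {P : ℝ} (hP : ‖p‖⁻¹ ^ 6 ≤ P) :
    (‖B p‖)⁻¹ ^ 6 ≤ (1 - m)⁻¹ ^ 6 * P ∧ (‖B p‖)⁻¹ ^ 12 ≤ (1 - m)⁻¹ ^ 12 * P := by
  obtain ⟨Q, hQ⟩ := hB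
  have hc0 : 0 < 1 - m := by linarith
  obtain ⟨x, hx⟩ : ∃ x : ℝ, ‖p‖ = x := ⟨_, rfl⟩
  rw [hx] at hp1 hP
  have hlow : (1 - m) * x ≤ ‖B p‖ := by
    have h1 := norm_sub_norm_le (Q p) (Q p - B p)
    rw [sub_sub_cancel, Q.norm_map] at h1
    have h2 : ‖Q p - B p‖ ≤ m * ‖p‖ := by rw [norm_sub_rev]; exact hQ _
    rw [hx] at h1 h2
    linarith
  obtain ⟨ρ, hρ⟩ : ∃ ρ : ℝ, ‖B p‖ = ρ := ⟨_, rfl⟩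
  rw [hρ] at hlow ⊢
  have hcx : 0 < (1 - m) * x := mul_pos hc0 (by linarith)
  have hy : ρ⁻¹ ≤ (1 - m)⁻¹ * x⁻¹ := by rw [← mul_inv]; exact inv_anti₀ hcx hlow
  have hy0 : 0 ≤ ρ⁻¹ := by
    have : 0 < ρ := lt_of_lt_of_le hcx hlow
    positivity
  have hxi0 : 0 ≤ x⁻¹ := by
    have : 0 < x := by linarith
    positivity
  have hxi1 : x⁻¹ ≤ 1 := inv_le_one_of_one_le₀ hp1
  have h6 : ρ⁻¹ ^ 6 ≤ (1 - m)⁻¹ ^ 6 * x⁻¹ ^ 6 := by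
    rw [← mul_pow]; exact pow_le_pow_left₀ hy0 hy 6
  have h12 : ρ⁻¹ ^ 12 ≤ (1 - m)⁻¹ ^ 12 * x⁻¹ ^ 6 := by
    have h12' : ρ⁻¹ ^ 12 ≤ (1 - m)⁻¹ ^ 12 * x⁻¹ ^ 12 := by
      rw [← mul_pow]; exact pow_le_pow_left₀ hy0 hy 12
    have hx12 : x⁻¹ ^ 12 ≤ x⁻¹ ^ 6 := pow_le_pow_of_le_one hxi0 hxi1 (by norm_num)
    exact h12'.trans (mul_le_mul_of_nonneg_left hx12 (by positivity))
  exact ⟨h6.trans (mul_le_mul_of_nonneg_left hP (by positivity)), h12.trans (mul_le_mul_of_nonneg_left hP (by positivity))⟩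

/-! ## §2 Layer sums: the registry-free building block -/

/-- The inverse `n`-th power LAYER TERM `‖B (layerVec i j o k)‖⁻ⁿ` at `(i, j)`. -/
noncomputable def layerTerm (B : E3 →ₗ[ℝ] E3) (n : ℕ) (k o : ℤ) (ij : ℤ × ℤ) : ℝ :=
  (‖B (layerVec ij.1 ij.2 o k)‖)⁻¹ ^ n

/-- The inverse `n`-th power LAYER SUM `Σ'_{(i,j) ∈ ℤ²} ‖B (layerVec i j o k)‖⁻ⁿ` of layer `k` with label `o` — a function of `B`, `k`, `o` only. -/
noncomputable def layerSum (B : E3 →ₗ[ℝ] E3) (n : ℕ) (k o : ℤ) : ℝ :=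
  ∑' ij : ℤ × ℤ, layerTerm B n k o ij

/-- The fibre over the layer index `k` of the g64 separable majorant: `272³ (1+k²)⁻¹ (1+i²)⁻¹ (1+j²)⁻¹`. -/
noncomputable def geomFiber (k : ℤ) (ij : ℤ × ℤ) : ℝ :=
  (272 : ℝ) ^ 3 * ((1 + (k : ℝ) ^ 2)⁻¹ * ((1 + (ij.1 : ℝ) ^ 2)⁻¹ * (1 + (ij.2 : ℝ) ^ 2)⁻¹))

/-- `layerTerm_nonneg` (docstring added by the landing lane; see the module docstring). [formal bookkeeping] -/
theorem layerTerm_nonneg (B : E3 →ₗ[ℝ] E3) (n : ℕ) (k o : ℤ) (ij : ℤ × ℤ) : 0 ≤ layerTerm B n k o ij := by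
  unfold layerTerm; positivity

/-- `layerSum_nonneg` (docstring added by the landing lane; see the module docstring). [formal bookkeeping] -/
theorem layerSum_nonneg (B : E3 →ₗ[ℝ] E3) (n : ℕ) (k o : ℤ) : 0 ≤ layerSum B n k o :=
  tsum_nonneg fun ij => layerTerm_nonneg B n k o ij

/-- `geomFiber_nonneg` (docstring added by the landing lane; see the module docstring). [formal bookkeeping] -/
theorem geomFiber_nonneg (k : ℤ) (ij : ℤ × ℤ) : 0 ≤ geomFiber k ij := by
  unfold geomFiber; positivity

/-- The fibre is summable over `ℤ²` (fibre of `summable_geomMajorant`). [this file] -/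
theorem summable_geomFiber (k : ℤ) : Summable (geomFiber k) :=
  summable_geomMajorant.prod_factor k

/-- `k ↦ Σ'_{ij} geomFiber k ij` is summable over `ℤ`. [this file] -/
theorem summable_tsum_geomFiber : Summable fun k : ℤ => ∑' ij : ℤ × ℤ, geomFiber k ij :=
  summable_geomMajorant.prod

/-- **Coset shift of the layer sum**: `layerSum B n k (o + 3q) = layerSum B n k o`. [this file] -/
theorem layerSum_add_three_mul (B : E3 →ₗ[ℝ] E3) (n : ℕ) (k o q : ℤ) : layerSum B n k (o + 3 * q) = layerSum B n k o := by
  unfold layerSum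
  have h : ∀ ij : ℤ × ℤ, layerTerm B n k (o + 3 * q) ij =
      layerTerm B n k o ((Equiv.prodCongr (Equiv.addRight q) (Equiv.addRight q)) ij) := fun ij => by
    show (‖B (layerVec ij.1 ij.2 (o + 3 * q) k)‖)⁻¹ ^ n = (‖B (layerVec (ij.1 + q) (ij.2 + q) o k)‖)⁻¹ ^ n
    rw [layerVec_add_three_mul]
  rw [tsum_congr h]
  exact (Equiv.prodCongr (Equiv.addRight q) (Equiv.addRight q)).tsum_eq (layerTerm B n k o)

/-- The layer sum depends on the label only through `o mod 3`. [this file] -/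
theorem layerSum_emod_three (B : E3 →ₗ[ℝ] E3) (n : ℕ) (k o : ℤ) : layerSum B n k o = layerSum B n k (o % 3) := by
  conv_lhs => rw [← Int.emod_add_mul_ediv o 3]
  exact layerSum_add_three_mul B n k (o % 3) (o / 3)

/-- **Coset MAX bound**: `layerSum B n k o ≤ max₃ (layerSum B n k 0, 1, 2)`. [this file] -/
theorem layerSum_le_max₃ (B : E3 →ₗ[ℝ] E3) (n : ℕ) (k o : ℤ) :
    layerSum B n k o ≤ max (layerSum B n k 0) (max (layerSum B n k 1) (layerSum B n k 2)) := by
  rw [layerSum_emod_three B n k o]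
  rcases (by omega : o % 3 = 0 ∨ o % 3 = 1 ∨ o % 3 = 2) with h | h | h <;> rw [h]
  · exact le_max_left _ _
  · exact (le_max_left _ _).trans (le_max_right _ _)
  · exact (le_max_right _ _).trans (le_max_right _ _)

/-- **Coset MIN bound**: `min₃ (layerSum B n k 0, 1, 2) ≤ layerSum B n k o`. [this file] -/
theorem min₃_le_layerSum (B : E3 →ₗ[ℝ] E3) (n : ℕ) (k o : ℤ) :
    min (layerSum B n k 0) (min (layerSum B n k 1) (layerSum B n k 2)) ≤ layerSum B n k o := by
  rw [layerSum_emod_three B n k o]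
  rcases (by omega : o % 3 = 0 ∨ o % 3 = 1 ∨ o % 3 = 2) with h | h | h <;> rw [h]
  · exact min_le_left _ _
  · exact (min_le_right _ _).trans (min_le_left _ _)
  · exact (min_le_right _ _).trans (min_le_right _ _)

/-- **Point-reflection symmetry**: `layerSum B n (−k) (−o) = layerSum B n k o` (`‖B(−p)‖ = ‖B p‖`) — halves the window table. [this file] -/
theorem layerSum_neg_neg (B : E3 →ₗ[ℝ] E3) (n : ℕ) (k o : ℤ) : layerSum B n (-k) (-o) = layerSum B n k o := by
  unfold layerSum
  have h : ∀ ij : ℤ × ℤ, layerTerm B n (-k) (-o) ij =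
      layerTerm B n k o ((Equiv.prodCongr (Equiv.neg ℤ) (Equiv.neg ℤ)) ij) := fun ij => by
    show (‖B (layerVec ij.1 ij.2 (-o) (-k))‖)⁻¹ ^ n = (‖B (layerVec (-ij.1) (-ij.2) o k)‖)⁻¹ ^ n
    rw [show layerVec ij.1 ij.2 (-o) (-k) = layerVec (-(-ij.1)) (-(-ij.2)) (-o) (-k) by rw [neg_neg, neg_neg], layerVec_neg,
      map_neg, norm_neg]
  rw [tsum_congr h]
  exact (Equiv.prodCongr (Equiv.neg ℤ) (Equiv.neg ℤ)).tsum_eq (layerTerm B n k o)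

/-- **Far-layer domination**: for `|o| ≤ |k|`, `2 ≤ |k|` and `B` within `m ≤ 1/6` of an isometry, `layerTerm B 6 k o ≤ (1−m)⁻⁶ geomFiber k` and
`layerTerm B 12 k o ≤ (1−m)⁻¹² geomFiber k` pointwise. [this file] -/
theorem layerTerm_far_le {B : E3 →ₗ[ℝ] E3} {m : ℝ} (hm : m ≤ 1 / 6) (hB : ∃ Q : E3 →ₗᵢ[ℝ] E3, ∀ v, ‖B v - Q v‖ ≤ m * ‖v‖)
    {k o : ℤ} (ho : |o| ≤ |k|) (hk : 2 ≤ |k|) (ij : ℤ × ℤ) :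
    layerTerm B 6 k o ij ≤ (1 - m)⁻¹ ^ 6 * geomFiber k ij ∧ layerTerm B 12 k o ij ≤ (1 - m)⁻¹ ^ 12 * geomFiber k ij :=
  inv_pow_norm_le_of_near hm hB (one_le_norm_layerVec hk ij.1 ij.2 o)
    (inv_pow_six_le_geom (one_le_norm_layerVec hk ij.1 ij.2 o) (sq_coord_le_norm_sq_layerVec ho ij.1 ij.2))

/-- The far-layer term families are summable over `ℤ²`. [this file] -/
theorem summable_layerTerm_far {B : E3 →ₗ[ℝ] E3} {m : ℝ} (hm : m ≤ 1 / 6) (hB : ∃ Q : E3 →ₗᵢ[ℝ] E3, ∀ v, ‖B v - Q v‖ ≤ m * ‖v‖)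
    {k o : ℤ} (ho : |o| ≤ |k|) (hk : 2 ≤ |k|) :
    Summable (layerTerm B 6 k o) ∧ Summable (layerTerm B 12 k o) :=
  ⟨Summable.of_nonneg_of_le (fun ij => layerTerm_nonneg B 6 k o ij) (fun ij => (layerTerm_far_le hm hB ho hk ij).1)
      ((summable_geomFiber k).mul_left _),
    Summable.of_nonneg_of_le (fun ij => layerTerm_nonneg B 12 k o ij) (fun ij => (layerTerm_far_le hm hB ho hk ij).2)
      ((summable_geomFiber k).mul_left _)⟩

/-- **Far-layer sum bounds**: `layerSum B 6 k o ≤ (1−m)⁻⁶ Σ' geomFiber k`, `layerSum B 12 k o ≤ (1−m)⁻¹² Σ' geomFiber k`. [this file] -/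
theorem layerSum_far_le {B : E3 →ₗ[ℝ] E3} {m : ℝ} (hm : m ≤ 1 / 6) (hB : ∃ Q : E3 →ₗᵢ[ℝ] E3, ∀ v, ‖B v - Q v‖ ≤ m * ‖v‖)
    {k o : ℤ} (ho : |o| ≤ |k|) (hk : 2 ≤ |k|) :
    layerSum B 6 k o ≤ (1 - m)⁻¹ ^ 6 * ∑' ij : ℤ × ℤ, geomFiber k ij ∧
      layerSum B 12 k o ≤ (1 - m)⁻¹ ^ 12 * ∑' ij : ℤ × ℤ, geomFiber k ij := by
  obtain ⟨h6, h12⟩ := summable_layerTerm_far hm hB ho hk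
  refine ⟨?_, ?_⟩
  · rw [← tsum_mul_left]
    exact h6.tsum_le_tsum (fun ij => (layerTerm_far_le hm hB ho hk ij).1) ((summable_geomFiber k).mul_left _)
  · rw [← tsum_mul_left]
    exact h12.tsum_le_tsum (fun ij => (layerTerm_far_le hm hB ho hk ij).2) ((summable_geomFiber k).mul_left _)

/-! ## §3 Fubini: the shape sums are sums of layer sums -/

/-- The `ℤ³`-indexed shape families of a chart are summable (g64 `summable_invSix_chart` / `summable_invTwelve_chart` at scale `1`). [this file] -/
theorem summable_shapeFamily {s : ℤ → ℤ} (hs : IsHaggSeq s) {B : E3 →ₗ[ℝ] E3} {m : ℝ} (hm : m ≤ 1 / 6)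
    (hB : ∃ Q : E3 →ₗᵢ[ℝ] E3, ∀ v, ‖B v - Q v‖ ≤ m * ‖v‖) :
    (Summable fun t : ℤ × ℤ × ℤ => layerTerm B 6 t.1 (haggLabel s t.1) t.2) ∧
      Summable fun t : ℤ × ℤ × ℤ => layerTerm B 12 t.1 (haggLabel s t.1) t.2 := by
  have h6 := (barlowEquiv s).summable_iff.2 (summable_invSix_chart hs hm hB one_pos)
  have h12 := (barlowEquiv s).summable_iff.2 (summable_invTwelve_chart hs hm hB one_pos)
  refine ⟨h6.congr fun t => ?_, h12.congr fun t => ?_⟩ <;>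
    simp only [Function.comp_apply, barlowEquiv_apply, one_mul, layerTerm, barlowTriple_eq_layerVec]

/-- The layer family `k ↦ layerSum c.B n k (haggLabel c.s k)` (`n = 6, 12`) of a chart near an isometry is summable, and each layer family is. [this file] -/
theorem summable_layerSum_chart {s : ℤ → ℤ} (hs : IsHaggSeq s) {B : E3 →ₗ[ℝ] E3} {m : ℝ} (hm : m ≤ 1 / 6)
    (hB : ∃ Q : E3 →ₗᵢ[ℝ] E3, ∀ v, ‖B v - Q v‖ ≤ m * ‖v‖) :
    (Summable fun k : ℤ => layerSum B 6 k (haggLabel s k)) ∧ (Summable fun k : ℤ => layerSum B 12 k (haggLabel s k)) ∧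
      (∀ k, Summable (layerTerm B 6 k (haggLabel s k))) ∧ ∀ k, Summable (layerTerm B 12 k (haggLabel s k)) := by
  obtain ⟨h6, h12⟩ := summable_shapeFamily hs hm hB
  exact ⟨h6.prod, h12.prod, fun k => h6.prod_factor k, fun k => h12.prod_factor k⟩

/-- ★ **Layer decomposition of `shapeSix`**: `shapeSix c = Σ'_k layerSum c.B 6 k (haggLabel c.s k)` for a chart with Hägg sequence and linear part
within `m ≤ 1/6` of an isometry. [this file] -/
theorem shapeSix_eq_tsum_layerSum (c : Chart) (hs : IsHaggSeq c.s) {m : ℝ} (hm : m ≤ 1 / 6)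
    (hB : ∃ Q : E3 →ₗᵢ[ℝ] E3, ∀ v, ‖c.B v - Q v‖ ≤ m * ‖v‖) :
    shapeSix c = ∑' k : ℤ, layerSum c.B 6 k (haggLabel c.s k) := by
  obtain ⟨h6, -⟩ := summable_shapeFamily hs hm hB
  unfold shapeSix
  rw [← (barlowEquiv c.s).tsum_eq]
  have h : ∀ t : ℤ × ℤ × ℤ, (‖c.B ((barlowEquiv c.s t : ↥(barlowStacking 1 (Real.sqrt (2 / 3)) c.s)) : E3)‖)⁻¹ ^ 6 =
      layerTerm c.B 6 t.1 (haggLabel c.s t.1) t.2 := fun t => by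
    simp only [barlowEquiv_apply, layerTerm, barlowTriple_eq_layerVec]
  rw [tsum_congr h, h6.tsum_prod]
  rfl

/-- ★ **Layer decomposition of `shapeTwelve`**. [this file] -/
theorem shapeTwelve_eq_tsum_layerSum (c : Chart) (hs : IsHaggSeq c.s) {m : ℝ} (hm : m ≤ 1 / 6)
    (hB : ∃ Q : E3 →ₗᵢ[ℝ] E3, ∀ v, ‖c.B v - Q v‖ ≤ m * ‖v‖) :
    shapeTwelve c = ∑' k : ℤ, layerSum c.B 12 k (haggLabel c.s k) := by
  obtain ⟨-, h12⟩ := summable_shapeFamily hs hm hB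
  unfold shapeTwelve
  rw [← (barlowEquiv c.s).tsum_eq]
  have h : ∀ t : ℤ × ℤ × ℤ, (‖c.B ((barlowEquiv c.s t : ↥(barlowStacking 1 (Real.sqrt (2 / 3)) c.s)) : E3)‖)⁻¹ ^ 12 =
      layerTerm c.B 12 t.1 (haggLabel c.s t.1) t.2 := fun t => by
    simp only [barlowEquiv_apply, layerTerm, barlowTriple_eq_layerVec]
  rw [tsum_congr h, h12.tsum_prod]
  rfl

end Summit.AtomisticToContinuum.Crystallization.Theorems.OverbindingBudgetAffineFarSmoothSplit
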